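import Literature.NumberTheory.GaloisRepresentations.CrystallineOrdinary
import Literature.NumberTheory.GaloisRepresentations.AbsGaloisGroupCompact
import HarnessLib

/-!
# Ordinary `ℚ̄_p`-representations of a prescribed inertial shape, and residual distinguishedness

Topic `Literature/NumberTheory/GaloisRepresentations`.  Let `K` be a non-archimedean local field
(intended `K = F_v`, `v ∣ p`), `Γ_K = Field.absoluteGaloisGroup K`, `I_K = absInertia K` its inertia
group, `ε = GaloisRep.cyclotomicCharacter K p : Γ_K →ₜ* ℤ_pˣ` the `p`-adic cyclotomic character and
`ρ : Γ_K →ₜ* GL_n(ℚ̄_p)` a framed representation (`FramedRep Γ_K (PadicAlgCl p) n`).  A **shape** is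
a vector `a : Fin n → ℕ` (intended non-decreasing; tree convention of `PAdicHodge` /
`InfinityType`: `ε` has Hodge–Tate weight `-1`, so `ε^{-a_i}` has Hodge–Tate weight `a_i`, and the
sub-object comes first: `a 0` is the weight of the invariant line).  Writing
`M(τ) = g ρ(τ) g⁻¹` for a frame `g ∈ GL_n(ℚ̄_p)`:

* `FramedRep.IsCrystallineOrdinaryOfShape ρ a` — the notion REQUESTED by route `GSpinRung`
  (`Summits/Langlands/Langlands/Theses/GSpinRung.lean`, items `stmt-Langlands-3391/3393/3394`, whose
  statements inline it verbatim for `a = (0,1,1,2,2,3)`): there is a frame in which every `M(τ)` is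
  upper triangular and, for `τ ∈ I_K`, `M(τ)_{ii} = ε(τ)^{-a_i}` (pushed into `ℚ̄_p` along
  `ℤ_p ⊆ ℚ_p → ℚ̄_p`, literally `algebraMap ℚ_[p] ℚ̄_p (↑↑(ε τ)⁻¹) ^ a i`).  Equivalently
  (`isCrystallineOrdinaryOfShape_iff_isCrystallineOrdinaryOfExponents`, proved): the accepted
  `FramedRep.IsCrystallineOrdinaryOfExponents p ρ (-a)` of `CrystallineOrdinary.lean` — upper
  triangular with diagonal characters `ψ_i ε^{-a_i}`, `ψ_i` unramified.
* `FramedRep.IsGreenbergOrdinaryOfShape ρ a` — the same frame condition PLUS: for `τ ∈ I_K` the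
  off-diagonal entries `M(τ)_{ij}`, `i ≠ j`, `a_i = a_j`, vanish, i.e. inertia acts on each block of
  equal weight `w` through the SCALAR `ε^{-w}`.  For non-decreasing `a` this is exactly Greenberg's
  ordinarity [Greenberg1991, §2] of the flag `Fil_w = ⟨e_i : a_i ≤ w⟩` (inertia acts on
  `gr_w = Fil_w / Fil_{w-1}` by `ε^{-w}`), written in a full-flag frame (always available over the
  algebraically closed field `ℚ̄_p`: `gr_w(w)` is an unramified representation, i.e. one of `Ẑ`,
  and a single matrix is triangularisable); for `a = (0,0,1,1)` on `GSp_4 ⊂ GL_4` it is the shape of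
  Boxer–Calegari–Gee–Pilloni's "`p`-distinguished weight `2` ordinary" representations
  [BoxerEtAl2021, §7.3, first Definition] (there the two Levi blocks are moreover DIAGONAL for all of
  `Γ_K`, which under their hypothesis `ᾱ_v ≠ β̄_v` is a further change of frame).
* `FramedRep.IsResiduallyDistinguishedOfShape ρ a` — the requested companion: a frame as in
  `IsCrystallineOrdinaryOfShape` in which, for every pair `i < j` with `a_i = a_j`, the two diagonal
  characters are residually distinct: `‖M(τ)_{ii} - M(τ)_{jj}‖ = 1` for some `τ ∈ Γ_K` (`‖·‖` the
  `p`-adic norm of `PadicAlgCl p`; the diagonal characters of an upper triangular `ρ` take values of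
  norm one, `FramedRep.IsUpperTriangular.norm_diagEntry_eq_one`, so `‖χ_i(τ) - χ_j(τ)‖ ≤ 1` with
  `< 1` iff `χ̄_i(τ) = χ̄_j(τ)`).  This is BCGP's "unit root crystalline eigenvalues are distinct
  modulo `p`" [BoxerEtAl2021, §1.1.1 (the modularity lifting theorem for abelian surfaces) and §7.3
  (`ᾱ_v ≠ β̄_v`)] for a general shape; for `n = 2`, `a = (0,0)` compare Skinner–Wiles'
  `p`-distinguishedness (`IsPDistinguishedAt`, `OrdinaryGaloisRep.lean`).
* Global versions at a finite place `v` of a number field `K` (intended `v ∣ p`), through the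
  accepted `FramedGaloisRep.toLocal v`: `FramedGaloisRep.IsCrystallineOrdinaryOfShapeAt v ρ a`,
  `FramedGaloisRep.IsGreenbergOrdinaryOfShapeAt v ρ a`, `FramedGaloisRep.IsResiduallyDistinguishedAt v ρ a`.

## WARNING: for repeated weights the requested notion is weaker than the literature's

Every printed "ordinary of weight `λ`" in full-flag form assumes REGULAR (pairwise distinct)
weights: Geraghty's "ordinary of weight `λ`" as quoted by Qian, Def. 1.2 (tree:
`OrdinaryRegular.lean`, `IsOrdinaryRegular`: `χ_i` agrees with `∏_τ τ(Art⁻¹σ)^{-(λ_{τ,n-i+1}+i-1)}` on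
an open subgroup of inertia — exponents strictly increasing in `i` for dominant `λ`), Thorne
[Thorne2012, Def. 3.9], Emerton–Gee [EmertonGee2022, Def. 6.4.1] ("Let `λ` be a regular `d`-tuple…").
All three predicates are INTENDED FOR NON-DECREASING `a` only (the flag of the frame is the index
order, the weights increase towards the quotient; for other `a` they are not a literature notion).
For strictly increasing shapes the two ordinarity predicates agree
(`isGreenbergOrdinaryOfShape_iff_of_injective`, proved).  For a shape with a REPEATED entry — the
route's `(0,1,1,2,2,3)`, BCGP's `(0,0,1,1)` — `IsCrystallineOrdinaryOfShape` does NOT imply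
`IsGreenbergOrdinaryOfShape`, even together with `IsResiduallyDistinguishedOfShape`: for unramified
characters `μ₁, μ₂ : Γ_{ℚ_p} → ℚ̄_pˣ` with `μ̄₁ ≠ μ̄₂` one has `h¹(Γ_{ℚ_p}, μ₁/μ₂) = 1` (local Euler
characteristic; `h⁰ = h² = 0`) while `H¹_ur = (μ₁/μ₂)/(Frob - 1) = 0`, so the non-split extension
`(μ₁ * ; 0 μ₂)` is RAMIFIED: it is upper triangular of shape `(0,0)` and residually distinguished, but
inertia acts on it through a non-trivial unipotent, so it is not Greenberg-ordinary — indeed not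
Hodge–Tate (Sen: Hodge–Tate of weights `(0,0)` would force finite, hence trivial, image of inertia).
Greenberg-ordinary representations are semi-stable (Perrin-Riou [PerrinRiou1994Ordinaires]); the
weak notion guarantees nothing of the sort inside a block of equal weights.  Ordinary deformation
rings and Hida theory (BCGP §7.3, Geraghty) see only the Greenberg form.  The planner of `GSpinRung`
is told (work-item note); this file vendors both, related by
`IsGreenbergOrdinaryOfShape.isCrystallineOrdinaryOfShape` (proved).

## Contents and API (all proved)

* verbatim unfoldings in the route's syntax (`isCrystallineOrdinaryOfShape_iff`,
  `isResiduallyDistinguishedOfShape_iff`, global `…At_iff`), and in terms of the accepted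
  `FramedRep.conj` / `IsUpperTriangular` / `diagEntry` (`…_iff_conj`);
* independence of the frame: `…_conj_iff` for all six predicates;
* shape `0` = "unramified up to unipotent" (`isCrystallineOrdinaryOfShape_zero_iff`); the trivial
  representation has Greenberg shape `0` (non-vacuity, `isGreenbergOrdinaryOfShape_one_zero`);
* the bridge with `CrystallineOrdinary.lean` (both directions) and, for strictly increasing `a`,
  `IsCrystallineOrdinaryOfShape.isCrystallineOrdinary`;
* norm-one values of diagonal characters of a compact group, the "residually equal" relation is a
  subgroup (`norm_diagEntry_sub_lt_one_mul/_inv`), a group is not the union of two proper subgroups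
  (`exists_norm_diagEntry_sub_eq_one_and`), whence the SINGLE-witness form of distinguishedness used
  by `GSpinRung` for `a = (0,1,1,2,2,3)`: `isResiduallyDistinguishedOfShape_gspin6_iff` /
  `FramedGaloisRep.isResiduallyDistinguishedAt_gspin6_iff` — literally the route's clause
  `∃ g, (triangular) ∧ (inertial diagonal) ∧ ∃ τ, ‖M τ 1 1 - M τ 2 2‖ = 1 ∧ ‖M τ 3 3 - M τ 4 4‖ = 1`.

NOT here (requested API that needs tree facts not yet proved): invariance under restriction to a
finite extension `K'/K` with `e = f = 1` (needs `absInertia_map_absGaloisRestrict_le`, a named fact of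
`LocalGaloisGroup.lean`, the compatibility of `GaloisRep.cyclotomicCharacter` with `absGaloisRestrict`,
and an identification `Γ_{K'_w} ≅ Γ_{K_v}`; none is in the tree).  Coefficients are `ℚ̄_p` only (the
request; general `ℤ_p`-algebras are served by `IsCrystallineOrdinaryOfExponents`).

## References

* R. Greenberg, *Iwasawa theory for motives*, LMS Lecture Note Ser. 153 (1991), §2. [Greenberg1991]
* G. Boxer, F. Calegari, T. Gee, V. Pilloni, *Abelian surfaces over totally real fields are
  potentially modular*, Publ. Math. IHÉS 134 (2021), §1.1.1 (modularity lifting theorem: good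
  ordinary reduction, unit root crystalline eigenvalues distinct mod `p`) and §7.3, first Definition
  (`p`-distinguished weight `2` ordinary); arXiv:1812.09269. [BoxerEtAl2021]
* D. Geraghty, *Modularity lifting theorems for ordinary Galois representations*, Math. Ann. 373
  (2019) (not held: acq-02323; cited for context only). [Geraghty2018]
* J. Thorne, *On the automorphy of `l`-adic Galois representations with small residual image*,
  J. Inst. Math. Jussieu 11 (2012), Def. 3.9. [Thorne2012]
* M. Emerton, T. Gee, *Moduli stacks of étale (φ, Γ)-modules…*, Ann. of Math. Stud. 215 (2022),
  Def. 6.4.1 (PDF p. 223). [EmertonGee2022]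
* B. Perrin-Riou, *Représentations p-adiques ordinaires*, Astérisque 223 (1994). [PerrinRiou1994Ordinaires]
-/

noncomputable section

open Field IsDedekindDomain
open scoped NumberField MatrixGroups

namespace Literature.NumberTheory.GaloisRepresentations

/-! ### Diagonal characters of a compact group over `ℚ̄_p`: norm one, residual equality -/

section CompactChar

variable {G : Type*} [Group G] [TopologicalSpace G] [CompactSpace G] {p : ℕ} [Fact p.Prime] {n : ℕ}

/-- **A continuous character of a compact group with values in `ℚ̄_pˣ` takes values of norm one**:
its image is bounded, and `‖χ(g)‖ ≠ 1` would make `‖χ(g^{±k})‖ = ‖χ(g)‖^{±k}` unbounded. [folklore] -/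
theorem norm_unitsChar_eq_one_of_continuous (χ : G →* (PadicAlgCl p)ˣ)
    (hχ : Continuous fun g => (χ g : PadicAlgCl p)) (g : G) : ‖(χ g : PadicAlgCl p)‖ = 1 := by
  obtain ⟨C, hC⟩ := (isCompact_range hχ.norm).bddAbove
  have hle : ∀ g : G, ‖(χ g : PadicAlgCl p)‖ ≤ 1 := fun g => not_lt.mp fun hlt => by
    obtain ⟨k, hk⟩ := pow_unbounded_of_one_lt C hlt
    have hk' : ‖(χ g : PadicAlgCl p)‖ ^ k ≤ C := by
      have := hC (Set.mem_range_self (g ^ k))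
      simpa only [map_pow, Units.val_pow_eq_pow_val, norm_pow] using this
    exact absurd hk' (not_le.mpr hk)
  refine le_antisymm (hle g) ?_
  have h1 := hle g⁻¹
  rw [map_inv, Units.val_inv_eq_inv_val, norm_inv] at h1
  exact (inv_le_one₀ (norm_pos_iff.mpr (Units.ne_zero _))).mp h1

namespace FramedRep.IsUpperTriangular

variable {ρ : FramedRep G (PadicAlgCl p) n}

/-- The diagonal characters `χ_i(g) = (ρ g)_{ii}` of an upper triangular framed representation of a
compact group over `ℚ̄_p` take values of norm one. [folklore] -/
theorem norm_diagEntry_eq_one (h : ρ.IsUpperTriangular) (i : Fin n) (g : G) :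
    ‖ρ.diagEntry i g‖ = 1 :=
  norm_unitsChar_eq_one_of_continuous (h.diagChar i) (ρ.continuous_diagEntry i) g

/-- `‖χ_i(g) - χ_j(g)‖ ≤ 1` (ultrametric inequality). [folklore] -/
theorem norm_diagEntry_sub_le_one (h : ρ.IsUpperTriangular) (i j : Fin n) (g : G) :
    ‖ρ.diagEntry i g - ρ.diagEntry j g‖ ≤ 1 :=
  calc ‖ρ.diagEntry i g - ρ.diagEntry j g‖ = ‖ρ.diagEntry i g + -ρ.diagEntry j g‖ := by
        rw [sub_eq_add_neg]
    _ ≤ max ‖ρ.diagEntry i g‖ ‖-ρ.diagEntry j g‖ := IsUltrametricDist.norm_add_le_max _ _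
    _ = 1 := by rw [norm_neg, h.norm_diagEntry_eq_one, h.norm_diagEntry_eq_one, max_self]

/-- **Residual equality `χ̄_i = χ̄_j` is stable under products**: if `‖χ_i - χ_j‖ < 1` at `σ` and at
`τ` then at `σ τ` (`χ_iχ_i' - χ_jχ_j' = χ_i(χ_i' - χ_j') + (χ_i - χ_j)χ_j'`). [folklore] -/
theorem norm_diagEntry_sub_lt_one_mul (h : ρ.IsUpperTriangular) {i j : Fin n} {σ τ : G}
    (hσ : ‖ρ.diagEntry i σ - ρ.diagEntry j σ‖ < 1) (hτ : ‖ρ.diagEntry i τ - ρ.diagEntry j τ‖ < 1) :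
    ‖ρ.diagEntry i (σ * τ) - ρ.diagEntry j (σ * τ)‖ < 1 := by
  rw [h.diagEntry_mul, h.diagEntry_mul]
  have e : ρ.diagEntry i σ * ρ.diagEntry i τ - ρ.diagEntry j σ * ρ.diagEntry j τ =
      ρ.diagEntry i σ * (ρ.diagEntry i τ - ρ.diagEntry j τ) +
        (ρ.diagEntry i σ - ρ.diagEntry j σ) * ρ.diagEntry j τ := by ring
  rw [e]
  refine (IsUltrametricDist.norm_add_le_max _ _).trans_lt (max_lt ?_ ?_)
  · rw [norm_mul, h.norm_diagEntry_eq_one, one_mul]; exact hτ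
  · rw [norm_mul, h.norm_diagEntry_eq_one, mul_one]; exact hσ

/-- **Residual equality `χ̄_i = χ̄_j` is stable under inverses.** [folklore] -/
theorem norm_diagEntry_sub_lt_one_inv (h : ρ.IsUpperTriangular) {i j : Fin n} {σ : G}
    (hσ : ‖ρ.diagEntry i σ - ρ.diagEntry j σ‖ < 1) :
    ‖ρ.diagEntry i σ⁻¹ - ρ.diagEntry j σ⁻¹‖ < 1 := by
  have hinv : ∀ k : Fin n, ρ.diagEntry k σ⁻¹ = (ρ.diagEntry k σ)⁻¹ := fun k => by
    have := congrArg Units.val (map_inv (h.diagChar k) σ)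
    rwa [Units.val_inv_eq_inv_val] at this
  have hne : ∀ k : Fin n, ρ.diagEntry k σ ≠ 0 := fun k =>
    norm_pos_iff.mp (by rw [h.norm_diagEntry_eq_one]; exact one_pos)
  rw [hinv, hinv, inv_sub_inv (hne i) (hne j), norm_div, norm_mul, h.norm_diagEntry_eq_one,
    h.norm_diagEntry_eq_one, mul_one, div_one, norm_sub_rev]
  exact hσ

/-- `‖χ_i(τ) - χ_j(τ)‖ = 1` iff not `< 1` (the norm is at most one). [folklore] -/
theorem norm_diagEntry_sub_eq_one_iff (h : ρ.IsUpperTriangular) (i j : Fin n) (τ : G) :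
    ‖ρ.diagEntry i τ - ρ.diagEntry j τ‖ = 1 ↔ ¬ ‖ρ.diagEntry i τ - ρ.diagEntry j τ‖ < 1 :=
  ⟨fun h1 h2 => by rw [h1] at h2; exact lt_irrefl _ h2,
    fun h2 => le_antisymm (h.norm_diagEntry_sub_le_one i j τ) (not_lt.mp h2)⟩

/-- **One witness for two pairs.**  If `χ̄_i ≠ χ̄_j` (some `τ₁` with `‖χ_i(τ₁) - χ_j(τ₁)‖ = 1`) and
`χ̄_k ≠ χ̄_l` (some `τ₂`), then a single `τ` witnesses both: the "residually equal" loci are proper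
subgroups (`norm_diagEntry_sub_lt_one_mul/_inv`) and a group is not the union of two proper
subgroups (`τ₁`, `τ₂` or `τ₁τ₂` works). [folklore] -/
theorem exists_norm_diagEntry_sub_eq_one_and (h : ρ.IsUpperTriangular) {i j k l : Fin n}
    (h₁ : ∃ τ, ‖ρ.diagEntry i τ - ρ.diagEntry j τ‖ = 1)
    (h₂ : ∃ τ, ‖ρ.diagEntry k τ - ρ.diagEntry l τ‖ = 1) :
    ∃ τ, ‖ρ.diagEntry i τ - ρ.diagEntry j τ‖ = 1 ∧ ‖ρ.diagEntry k τ - ρ.diagEntry l τ‖ = 1 := by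
  obtain ⟨τ₁, h₁⟩ := h₁
  obtain ⟨τ₂, h₂⟩ := h₂
  by_cases hA : ‖ρ.diagEntry k τ₁ - ρ.diagEntry l τ₁‖ < 1
  · by_cases hB : ‖ρ.diagEntry i τ₂ - ρ.diagEntry j τ₂‖ < 1
    · refine ⟨τ₁ * τ₂, (h.norm_diagEntry_sub_eq_one_iff _ _ _).2 fun hlt => ?_,
        (h.norm_diagEntry_sub_eq_one_iff _ _ _).2 fun hlt => ?_⟩
      · have h' := h.norm_diagEntry_sub_lt_one_mul hlt (h.norm_diagEntry_sub_lt_one_inv hB)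
        rw [mul_inv_cancel_right] at h'
        exact (h.norm_diagEntry_sub_eq_one_iff _ _ _).1 h₁ h'
      · have h' := h.norm_diagEntry_sub_lt_one_mul (h.norm_diagEntry_sub_lt_one_inv hA) hlt
        rw [inv_mul_cancel_left] at h'
        exact (h.norm_diagEntry_sub_eq_one_iff _ _ _).1 h₂ h'
    · exact ⟨τ₂, (h.norm_diagEntry_sub_eq_one_iff _ _ _).2 hB, h₂⟩
  · exact ⟨τ₁, h₁, (h.norm_diagEntry_sub_eq_one_iff _ _ _).2 hA⟩

end FramedRep.IsUpperTriangular

end CompactChar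

/-! ### The cyclotomic character in `ℚ̄_p` and the unramified twists of diagonal characters -/

section CycTwist

variable {K : Type} [Field K] {p : ℕ} [Fact p.Prime] {n : ℕ}

/-- Pushing a `p`-adic unit into `ℚ̄_p` through `ℤ_p → ℚ̄_p` or through `ℤ_p ⊆ ℚ_p → ℚ̄_p` agree
(`IsScalarTower ℤ_p ℚ_p ℚ̄_p`). [folklore] -/
theorem val_unitsMap_algebraMap_padicAlgCl (u : ℤ_[p]ˣ) :
    ((Units.map (algebraMap ℤ_[p] (PadicAlgCl p)).toMonoidHom u : (PadicAlgCl p)ˣ) : PadicAlgCl p) =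
      algebraMap ℚ_[p] (PadicAlgCl p) ((u : ℤ_[p]) : ℚ_[p]) := by
  rw [Units.coe_map, RingHom.toMonoidHom_eq_coe, MonoidHom.coe_coe,
    IsScalarTower.algebraMap_apply ℤ_[p] ℚ_[p] (PadicAlgCl p), PadicInt.algebraMap_apply]

/-- The route's power `ι((ε τ)⁻¹)^c` of the inverse cyclotomic character equals the `(-c)`-th power
of `ε(τ)` in the group `ℚ̄_pˣ` (the form used by `IsCrystallineOrdinaryOfExponents`). [folklore] -/
theorem algebraMap_inv_cyclotomicCharacter_pow (τ : absoluteGaloisGroup K) (c : ℕ) :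
    algebraMap ℚ_[p] (PadicAlgCl p)
        ((((GaloisRep.cyclotomicCharacter K p τ)⁻¹ : ℤ_[p]ˣ) : ℤ_[p]) : ℚ_[p]) ^ c =
      ((Units.map (algebraMap ℤ_[p] (PadicAlgCl p)).toMonoidHom
            (GaloisRep.cyclotomicCharacter K p τ) ^ (-(c : ℤ)) : (PadicAlgCl p)ˣ) : PadicAlgCl p) := by
  rw [zpow_neg, zpow_natCast, ← inv_pow,
    ← map_inv (Units.map (algebraMap ℤ_[p] (PadicAlgCl p)).toMonoidHom), Units.val_pow_eq_pow_val,
    val_unitsMap_algebraMap_padicAlgCl]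

/-- Continuity of `σ ↦ ε(σ) ∈ ℚ̄_p` (`ℤ_p ⊆ ℚ_p` and `ℚ_p → ℚ̄_p` are continuous). [folklore] -/
theorem continuous_algebraMap_cyclotomicCharacter :
    Continuous fun σ : absoluteGaloisGroup K =>
      ((Units.map (algebraMap ℤ_[p] (PadicAlgCl p)).toMonoidHom
          (GaloisRep.cyclotomicCharacter K p σ) : (PadicAlgCl p)ˣ) : PadicAlgCl p) := by
  simp only [val_unitsMap_algebraMap_padicAlgCl]
  have h1 : Continuous fun σ : absoluteGaloisGroup K =>
      ((GaloisRep.cyclotomicCharacter K p σ : ℤ_[p]ˣ) : ℤ_[p]) :=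
    Units.continuous_val.comp (map_continuous _)
  have h2 : Continuous fun x : ℤ_[p] => (x : ℚ_[p]) := continuous_subtype_val
  exact (continuous_algebraMap ℚ_[p] (PadicAlgCl p)).comp (h2.comp h1)

/-- For an upper triangular `ρ : Γ_K →ₜ* GL_n(ℚ̄_p)`, the **cyclotomic twist `χ_i ε^{c}`** of its
`i`-th diagonal character (`IsUpperTriangular.diagChar`), as a continuous character `Γ_K →ₜ* ℚ̄_pˣ`
(for an ordinary `ρ` of shape `a` and `c = a_i` this is the unramified character `ψ_i`).
[folklore] -/
def FramedRep.IsUpperTriangular.diagCharCycTwist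
    {ρ : FramedRep (absoluteGaloisGroup K) (PadicAlgCl p) n} (h : ρ.IsUpperTriangular) (i : Fin n)
    (c : ℕ) : absoluteGaloisGroup K →ₜ* (PadicAlgCl p)ˣ where
  toFun σ := h.diagChar i σ *
    (Units.map (algebraMap ℤ_[p] (PadicAlgCl p)).toMonoidHom (GaloisRep.cyclotomicCharacter K p σ)) ^ c
  map_one' := by simp
  map_mul' σ σ' := by
    simp only [map_mul, mul_pow]
    exact mul_mul_mul_comm _ _ _ _
  continuous_toFun := by
    refine Units.isEmbedding_val₀.continuous_iff.2 ?_
    simp only [Function.comp_def, Units.val_mul, Units.val_pow_eq_pow_val,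
      FramedRep.IsUpperTriangular.val_diagChar_apply]
    exact (ρ.continuous_diagEntry i).mul (continuous_algebraMap_cyclotomicCharacter.pow c)

/-- Values of `diagCharCycTwist`: `(χ_i ε^c)(σ) = (ρ σ)_{ii} · ε(σ)^c`. [folklore] -/
@[simp] theorem FramedRep.IsUpperTriangular.val_diagCharCycTwist_apply
    {ρ : FramedRep (absoluteGaloisGroup K) (PadicAlgCl p) n} (h : ρ.IsUpperTriangular) (i : Fin n)
    (c : ℕ) (σ : absoluteGaloisGroup K) :
    (h.diagCharCycTwist i c σ : PadicAlgCl p) = ρ.diagEntry i σ *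
      ((Units.map (algebraMap ℤ_[p] (PadicAlgCl p)).toMonoidHom
          (GaloisRep.cyclotomicCharacter K p σ) : (PadicAlgCl p)ˣ) : PadicAlgCl p) ^ c := by
  show ((h.diagChar i σ * (Units.map (algebraMap ℤ_[p] (PadicAlgCl p)).toMonoidHom
    (GaloisRep.cyclotomicCharacter K p σ)) ^ c : (PadicAlgCl p)ˣ) : PadicAlgCl p) = _
  rw [Units.val_mul, Units.val_pow_eq_pow_val, FramedRep.IsUpperTriangular.val_diagChar_apply]

/-- `diagCharCycTwist` as a **rank-one framed representation** `Γ_K →ₜ* GL_1(ℚ̄_p)` (through the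
accepted `FramedRep.unitsContinuousMulEquivOfUnique`). [folklore] -/
def FramedRep.IsUpperTriangular.diagCharCycTwistFramed
    {ρ : FramedRep (absoluteGaloisGroup K) (PadicAlgCl p) n} (h : ρ.IsUpperTriangular) (i : Fin n)
    (c : ℕ) : FramedRep (absoluteGaloisGroup K) (PadicAlgCl p) 1 :=
  ContinuousMonoidHom.comp
    (FramedRep.unitsContinuousMulEquivOfUnique (Fin 1) (PadicAlgCl p) :
      (PadicAlgCl p)ˣ →ₜ* GL (Fin 1) (PadicAlgCl p))
    (h.diagCharCycTwist i c)

/-- The entries of the `1 × 1` matrix `diagCharCycTwistFramed … σ`. [folklore] -/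
theorem FramedRep.IsUpperTriangular.diagCharCycTwistFramed_apply_val
    {ρ : FramedRep (absoluteGaloisGroup K) (PadicAlgCl p) n} (h : ρ.IsUpperTriangular) (i : Fin n)
    (c : ℕ) (σ : absoluteGaloisGroup K) (k l : Fin 1) :
    ((h.diagCharCycTwistFramed i c σ : GL (Fin 1) (PadicAlgCl p)) :
        Matrix (Fin 1) (Fin 1) (PadicAlgCl p)) k l = (h.diagCharCycTwist i c σ : PadicAlgCl p) :=
  rfl

/-- The trace of the rank-one representation `diagCharCycTwistFramed` is the character itself.
[folklore] -/
theorem FramedRep.IsUpperTriangular.trace_diagCharCycTwistFramed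
    {ρ : FramedRep (absoluteGaloisGroup K) (PadicAlgCl p) n} (h : ρ.IsUpperTriangular) (i : Fin n)
    (c : ℕ) (σ : absoluteGaloisGroup K) :
    (h.diagCharCycTwistFramed i c).trace σ = (h.diagCharCycTwist i c σ : PadicAlgCl p) := by
  rw [FramedRep.trace, Matrix.trace_fin_one]
  rfl

end CycTwist

/-! ### The local predicates -/

section Local

variable {K : Type} [Field K] [ValuativeRel K] [TopologicalSpace K] [IsNonarchimedeanLocalField K]
  {p : ℕ} [Fact p.Prime] {n : ℕ}

/-- **`ρ : Γ_K →ₜ* GL_n(ℚ̄_p)` is (crystalline-)ordinary of inertial shape `a : Fin n → ℕ`** — the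
clause inlined by route `GSpinRung`: there is a frame `g ∈ GL_n(ℚ̄_p)` such that every
`M(τ) = g ρ(τ) g⁻¹` is upper triangular and, for `τ` in the inertia group `I_K = absInertia K`,
`M(τ)_{ii} = ε(τ)^{-a_i}`, `ε = GaloisRep.cyclotomicCharacter K p` (pushed along `ℤ_p ⊆ ℚ_p → ℚ̄_p`);
i.e. `ρ` has a full `Γ_K`-stable flag whose `i`-th diagonal character is `ψ_i ε^{-a_i}` with `ψ_i`
unramified (`isCrystallineOrdinaryOfShape_iff_isCrystallineOrdinaryOfExponents`), the invariant line
having Hodge–Tate weight `a_0` (tree convention `HT(ε) = -1`; `H¹` of a good ordinary elliptic curve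
has shape `(0,1)`).  Intended for NON-DECREASING `a`.  For STRICTLY INCREASING `a` this is
Greenberg's ordinarity for a full flag (= `IsGreenbergOrdinaryOfShape`,
`isGreenbergOrdinaryOfShape_iff_of_injective`) and the regular-weight notion of Geraghty / Thorne
(Def. 3.9, here with `ψ_i` unramified on all of `I_K`) / Emerton–Gee (Def. 6.4.1); for a non-decreasing
shape with REPEATED entries it is strictly WEAKER than Greenberg's condition (module docstring:
ramified extensions of distinct unramified characters) and does not imply semi-stability.
[cite: Greenberg1991, §2 (ordinary p-adic representation; full-flag form, diagonal condition only)] -/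
def FramedRep.IsCrystallineOrdinaryOfShape (ρ : FramedRep (absoluteGaloisGroup K) (PadicAlgCl p) n)
    (a : Fin n → ℕ) : Prop :=
  ∃ g : GL (Fin n) (PadicAlgCl p),
    (∀ (τ : absoluteGaloisGroup K) (i j : Fin n), j < i →
        ((g * ρ τ * g⁻¹ : GL (Fin n) (PadicAlgCl p)) : Matrix (Fin n) (Fin n) (PadicAlgCl p)) i j = 0) ∧
      ∀ τ ∈ absInertia K, ∀ i : Fin n,
        ((g * ρ τ * g⁻¹ : GL (Fin n) (PadicAlgCl p)) : Matrix (Fin n) (Fin n) (PadicAlgCl p)) i i =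
          algebraMap ℚ_[p] (PadicAlgCl p)
            ((((GaloisRep.cyclotomicCharacter K p τ)⁻¹ : ℤ_[p]ˣ) : ℤ_[p]) : ℚ_[p]) ^ a i

/-- **`ρ : Γ_K →ₜ* GL_n(ℚ̄_p)` is Greenberg-ordinary of inertial shape `a`** (with cyclotomic
inertia, in a full-flag frame): there is a frame `g` such that every `M(τ) = g ρ(τ) g⁻¹` is upper
triangular and, for `τ ∈ I_K`, `M(τ)_{ii} = ε(τ)^{-a_i}` AND `M(τ)_{ij} = 0` whenever `i ≠ j`,
`a_i = a_j` — inertia acts on each block of equal weight `w` through the scalar `ε^{-w}`.  For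
non-decreasing `a` this is Greenberg's definition [Greenberg1991, §2] for the flag
`Fil_w = ⟨e_i : a_i ≤ w⟩` (graded pieces `gr_w` of dimension `#{i : a_i = w}`, inertia acting on
`gr_w` by `ε^{-w}`), refined to a full flag (possible over `ℚ̄_p`); for `a = (0,0,1,1)` it is the
shape of Boxer–Calegari–Gee–Pilloni's `p`-distinguished weight-`2` ordinary representations
`(λ_α, λ_β, ε⁻¹λ_β⁻¹, ε⁻¹λ_α⁻¹)` [BoxerEtAl2021, §7.3].  Greenberg-ordinary ⇒ semi-stable
(Perrin-Riou; not vendored).  Implies `IsCrystallineOrdinaryOfShape`, and coincides with it for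
injective `a`; intended for non-decreasing `a` only (for other `a` the frame's flag contradicts the
weight order and the predicate is not a literature notion).
[cite: Greenberg1991, §2 (definition of an ordinary p-adic representation)] -/
def FramedRep.IsGreenbergOrdinaryOfShape (ρ : FramedRep (absoluteGaloisGroup K) (PadicAlgCl p) n)
    (a : Fin n → ℕ) : Prop :=
  ∃ g : GL (Fin n) (PadicAlgCl p),
    (∀ (τ : absoluteGaloisGroup K) (i j : Fin n), j < i →
        ((g * ρ τ * g⁻¹ : GL (Fin n) (PadicAlgCl p)) : Matrix (Fin n) (Fin n) (PadicAlgCl p)) i j = 0) ∧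
      (∀ τ ∈ absInertia K, ∀ i : Fin n,
        ((g * ρ τ * g⁻¹ : GL (Fin n) (PadicAlgCl p)) : Matrix (Fin n) (Fin n) (PadicAlgCl p)) i i =
          algebraMap ℚ_[p] (PadicAlgCl p)
            ((((GaloisRep.cyclotomicCharacter K p τ)⁻¹ : ℤ_[p]ˣ) : ℤ_[p]) : ℚ_[p]) ^ a i) ∧
      ∀ τ ∈ absInertia K, ∀ i j : Fin n, i ≠ j → a i = a j →
        ((g * ρ τ * g⁻¹ : GL (Fin n) (PadicAlgCl p)) : Matrix (Fin n) (Fin n) (PadicAlgCl p)) i j = 0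

/-- **`ρ : Γ_K →ₜ* GL_n(ℚ̄_p)` is ordinary of shape `a` with residually distinguished characters of
equal weight** ("`p`-distinguished"): there is a frame as in `IsCrystallineOrdinaryOfShape` (upper
triangular, inertial diagonal `ε^{-a_i}`) in which, for every pair `i < j` with `a_i = a_j`, the
diagonal characters `χ_i, χ_j` are residually distinct: `‖M(τ)_{ii} - M(τ)_{jj}‖ = 1` for some
`τ ∈ Γ_K` (`‖·‖` the `p`-adic norm of `ℚ̄_p`; always `≤ 1`, and `< 1` iff `χ̄_i(τ) = χ̄_j(τ)`,
`IsUpperTriangular.norm_diagEntry_sub_le_one`).  Boxer–Calegari–Gee–Pilloni's hypothesis "the unit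
root crystalline eigenvalues are distinct modulo `p`" / `ᾱ_v ≠ β̄_v` for shape `(0,0,1,1)`
[BoxerEtAl2021, §1.1.1 and §7.3]; route `GSpinRung` uses shape `(0,1,1,2,2,3)`
(`isResiduallyDistinguishedOfShape_gspin6_iff`).  Built on the requested (weak) ordinarity, see the
module docstring.
[cite: BoxerEtAl2021, §7.3 (first Definition: ᾱ_v ≠ β̄_v)] -/
def FramedRep.IsResiduallyDistinguishedOfShape
    (ρ : FramedRep (absoluteGaloisGroup K) (PadicAlgCl p) n) (a : Fin n → ℕ) : Prop :=
  ∃ g : GL (Fin n) (PadicAlgCl p),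
    (∀ (τ : absoluteGaloisGroup K) (i j : Fin n), j < i →
        ((g * ρ τ * g⁻¹ : GL (Fin n) (PadicAlgCl p)) : Matrix (Fin n) (Fin n) (PadicAlgCl p)) i j = 0) ∧
      (∀ τ ∈ absInertia K, ∀ i : Fin n,
        ((g * ρ τ * g⁻¹ : GL (Fin n) (PadicAlgCl p)) : Matrix (Fin n) (Fin n) (PadicAlgCl p)) i i =
          algebraMap ℚ_[p] (PadicAlgCl p)
            ((((GaloisRep.cyclotomicCharacter K p τ)⁻¹ : ℤ_[p]ˣ) : ℤ_[p]) : ℚ_[p]) ^ a i) ∧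
      ∀ i j : Fin n, i < j → a i = a j → ∃ τ : absoluteGaloisGroup K,
        ‖((g * ρ τ * g⁻¹ : GL (Fin n) (PadicAlgCl p)) : Matrix (Fin n) (Fin n) (PadicAlgCl p)) i i -
            ((g * ρ τ * g⁻¹ : GL (Fin n) (PadicAlgCl p)) : Matrix (Fin n) (Fin n) (PadicAlgCl p)) j j‖ = 1

/-! #### Unfoldings -/

/-- **The route's shape, verbatim**: `IsCrystallineOrdinaryOfShape` is the clause of `GSpinRung`
(`let M := fun τ => ↑(g * ρ τ * g⁻¹); (below-diagonal entries vanish) ∧ (inertial diagonal)`), with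
`ρ` for the route's `ρ.toLocal v` and `a i` for its `(![0, 1, 1, 2, 2, 3] i : ℕ)`. [folklore] -/
theorem FramedRep.isCrystallineOrdinaryOfShape_iff
    (ρ : FramedRep (absoluteGaloisGroup K) (PadicAlgCl p) n) (a : Fin n → ℕ) :
    ρ.IsCrystallineOrdinaryOfShape a ↔
      ∃ g : GL (Fin n) (PadicAlgCl p),
        let M := fun τ =>
          ((g * ρ τ * g⁻¹ : GL (Fin n) (PadicAlgCl p)) : Matrix (Fin n) (Fin n) (PadicAlgCl p));
        (∀ τ (i j : Fin n), j < i → M τ i j = 0) ∧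
          (∀ τ ∈ absInertia K, ∀ i : Fin n, M τ i i =
            algebraMap ℚ_[p] (PadicAlgCl p)
              ((((GaloisRep.cyclotomicCharacter K p τ)⁻¹ : ℤ_[p]ˣ) : ℤ_[p]) : ℚ_[p]) ^ (a i : ℕ)) :=
  Iff.rfl

/-- `IsCrystallineOrdinaryOfShape` through the accepted `FramedRep.conj`, `IsUpperTriangular`,
`diagEntry`: `∃ g, (ρ.conj g) upper triangular ∧ ∀ τ ∈ I_K, ∀ i, diagEntry (ρ.conj g) i τ = ε(τ)^{-a_i}`.
[folklore] -/
theorem FramedRep.isCrystallineOrdinaryOfShape_iff_conj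
    (ρ : FramedRep (absoluteGaloisGroup K) (PadicAlgCl p) n) (a : Fin n → ℕ) :
    ρ.IsCrystallineOrdinaryOfShape a ↔
      ∃ g : GL (Fin n) (PadicAlgCl p), (ρ.conj g).IsUpperTriangular ∧
        ∀ τ ∈ absInertia K, ∀ i : Fin n, (ρ.conj g).diagEntry i τ =
          algebraMap ℚ_[p] (PadicAlgCl p)
            ((((GaloisRep.cyclotomicCharacter K p τ)⁻¹ : ℤ_[p]ˣ) : ℤ_[p]) : ℚ_[p]) ^ a i :=
  Iff.rfl

/-- `IsGreenbergOrdinaryOfShape` through `FramedRep.conj`, `IsUpperTriangular`, `diagEntry`.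
[folklore] -/
theorem FramedRep.isGreenbergOrdinaryOfShape_iff_conj
    (ρ : FramedRep (absoluteGaloisGroup K) (PadicAlgCl p) n) (a : Fin n → ℕ) :
    ρ.IsGreenbergOrdinaryOfShape a ↔
      ∃ g : GL (Fin n) (PadicAlgCl p), (ρ.conj g).IsUpperTriangular ∧
        (∀ τ ∈ absInertia K, ∀ i : Fin n, (ρ.conj g).diagEntry i τ =
          algebraMap ℚ_[p] (PadicAlgCl p)
            ((((GaloisRep.cyclotomicCharacter K p τ)⁻¹ : ℤ_[p]ˣ) : ℤ_[p]) : ℚ_[p]) ^ a i) ∧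
        ∀ τ ∈ absInertia K, ∀ i j : Fin n, i ≠ j → a i = a j →
          ((ρ.conj g τ : GL (Fin n) (PadicAlgCl p)) : Matrix (Fin n) (Fin n) (PadicAlgCl p)) i j = 0 :=
  Iff.rfl

/-- **The route's shape, verbatim** for the distinguished predicate. [folklore] -/
theorem FramedRep.isResiduallyDistinguishedOfShape_iff
    (ρ : FramedRep (absoluteGaloisGroup K) (PadicAlgCl p) n) (a : Fin n → ℕ) :
    ρ.IsResiduallyDistinguishedOfShape a ↔
      ∃ g : GL (Fin n) (PadicAlgCl p),
        let M := fun τ =>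
          ((g * ρ τ * g⁻¹ : GL (Fin n) (PadicAlgCl p)) : Matrix (Fin n) (Fin n) (PadicAlgCl p));
        (∀ τ (i j : Fin n), j < i → M τ i j = 0) ∧
          (∀ τ ∈ absInertia K, ∀ i : Fin n, M τ i i =
            algebraMap ℚ_[p] (PadicAlgCl p)
              ((((GaloisRep.cyclotomicCharacter K p τ)⁻¹ : ℤ_[p]ˣ) : ℤ_[p]) : ℚ_[p]) ^ (a i : ℕ)) ∧
          ∀ i j : Fin n, i < j → a i = a j → ∃ τ, ‖M τ i i - M τ j j‖ = 1 :=
  Iff.rfl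

/-- `IsResiduallyDistinguishedOfShape` through `FramedRep.conj`, `IsUpperTriangular`, `diagEntry`.
[folklore] -/
theorem FramedRep.isResiduallyDistinguishedOfShape_iff_conj
    (ρ : FramedRep (absoluteGaloisGroup K) (PadicAlgCl p) n) (a : Fin n → ℕ) :
    ρ.IsResiduallyDistinguishedOfShape a ↔
      ∃ g : GL (Fin n) (PadicAlgCl p), (ρ.conj g).IsUpperTriangular ∧
        (∀ τ ∈ absInertia K, ∀ i : Fin n, (ρ.conj g).diagEntry i τ =
          algebraMap ℚ_[p] (PadicAlgCl p)
            ((((GaloisRep.cyclotomicCharacter K p τ)⁻¹ : ℤ_[p]ˣ) : ℤ_[p]) : ℚ_[p]) ^ a i) ∧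
        ∀ i j : Fin n, i < j → a i = a j →
          ∃ τ, ‖(ρ.conj g).diagEntry i τ - (ρ.conj g).diagEntry j τ‖ = 1 :=
  Iff.rfl

/-! #### Comparison of the three predicates -/

/-- Greenberg-ordinary of shape `a` ⇒ ordinary of shape `a` (drop the block condition). [folklore] -/
theorem FramedRep.IsGreenbergOrdinaryOfShape.isCrystallineOrdinaryOfShape
    {ρ : FramedRep (absoluteGaloisGroup K) (PadicAlgCl p) n} {a : Fin n → ℕ}
    (h : ρ.IsGreenbergOrdinaryOfShape a) : ρ.IsCrystallineOrdinaryOfShape a := by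
  obtain ⟨g, htri, hdiag, -⟩ := h
  exact ⟨g, htri, hdiag⟩

/-- For an INJECTIVE shape (pairwise distinct weights) ordinary ⇒ Greenberg-ordinary (the block
condition is vacuous). [folklore] -/
theorem FramedRep.IsCrystallineOrdinaryOfShape.isGreenbergOrdinaryOfShape_of_injective
    {ρ : FramedRep (absoluteGaloisGroup K) (PadicAlgCl p) n} {a : Fin n → ℕ}
    (h : ρ.IsCrystallineOrdinaryOfShape a) (ha : Function.Injective a) :
    ρ.IsGreenbergOrdinaryOfShape a := by
  obtain ⟨g, htri, hdiag⟩ := h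
  exact ⟨g, htri, hdiag, fun τ _ i j hij ha' => absurd (ha ha') hij⟩

/-- For an injective shape the two ordinarity predicates coincide. [folklore] -/
theorem FramedRep.isGreenbergOrdinaryOfShape_iff_of_injective
    (ρ : FramedRep (absoluteGaloisGroup K) (PadicAlgCl p) n) {a : Fin n → ℕ}
    (ha : Function.Injective a) :
    ρ.IsGreenbergOrdinaryOfShape a ↔ ρ.IsCrystallineOrdinaryOfShape a :=
  ⟨fun h => h.isCrystallineOrdinaryOfShape, fun h => h.isGreenbergOrdinaryOfShape_of_injective ha⟩

/-- Residually distinguished of shape `a` ⇒ ordinary of shape `a`. [folklore] -/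
theorem FramedRep.IsResiduallyDistinguishedOfShape.isCrystallineOrdinaryOfShape
    {ρ : FramedRep (absoluteGaloisGroup K) (PadicAlgCl p) n} {a : Fin n → ℕ}
    (h : ρ.IsResiduallyDistinguishedOfShape a) : ρ.IsCrystallineOrdinaryOfShape a := by
  obtain ⟨g, htri, hdiag, -⟩ := h
  exact ⟨g, htri, hdiag⟩

/-- For an injective shape, ordinary ⇒ residually distinguished (no pair to distinguish). [folklore] -/
theorem FramedRep.IsCrystallineOrdinaryOfShape.isResiduallyDistinguishedOfShape_of_injective
    {ρ : FramedRep (absoluteGaloisGroup K) (PadicAlgCl p) n} {a : Fin n → ℕ}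
    (h : ρ.IsCrystallineOrdinaryOfShape a) (ha : Function.Injective a) :
    ρ.IsResiduallyDistinguishedOfShape a := by
  obtain ⟨g, htri, hdiag⟩ := h
  exact ⟨g, htri, hdiag, fun i j hij ha' => absurd (ha ha') hij.ne⟩

/-! #### Independence of the frame -/

omit [ValuativeRel K] [TopologicalSpace K] [IsNonarchimedeanLocalField K] in
/-- Re-framing a conjugate: `g (P ρ(τ) P⁻¹) g⁻¹ = (gP) ρ(τ) (gP)⁻¹`. [folklore] -/
private lemma conj_frame_eq (g P : GL (Fin n) (PadicAlgCl p))
    (ρ : FramedRep (absoluteGaloisGroup K) (PadicAlgCl p) n) (τ : absoluteGaloisGroup K) :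
    g * ρ.conj P τ * g⁻¹ = g * P * ρ τ * (g * P)⁻¹ := by
  rw [FramedRep.conj_apply]; group

/-- **Ordinarity of shape `a` does not see the frame**: `P ρ P⁻¹` is ordinary of shape `a` iff `ρ`
is (frames `g P`, resp. `g P⁻¹`). [folklore] -/
theorem FramedRep.isCrystallineOrdinaryOfShape_conj_iff (P : GL (Fin n) (PadicAlgCl p))
    (ρ : FramedRep (absoluteGaloisGroup K) (PadicAlgCl p) n) (a : Fin n → ℕ) :
    (ρ.conj P).IsCrystallineOrdinaryOfShape a ↔ ρ.IsCrystallineOrdinaryOfShape a := by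
  constructor
  · rintro ⟨g, h⟩
    exact ⟨g * P, by simpa only [conj_frame_eq] using h⟩
  · rintro ⟨g, h⟩
    refine ⟨g * P⁻¹, ?_⟩
    simpa only [conj_frame_eq, inv_mul_cancel_right] using h

/-- **Greenberg-ordinarity of shape `a` does not see the frame.** [folklore] -/
theorem FramedRep.isGreenbergOrdinaryOfShape_conj_iff (P : GL (Fin n) (PadicAlgCl p))
    (ρ : FramedRep (absoluteGaloisGroup K) (PadicAlgCl p) n) (a : Fin n → ℕ) :
    (ρ.conj P).IsGreenbergOrdinaryOfShape a ↔ ρ.IsGreenbergOrdinaryOfShape a := by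
  constructor
  · rintro ⟨g, h⟩
    exact ⟨g * P, by simpa only [conj_frame_eq] using h⟩
  · rintro ⟨g, h⟩
    refine ⟨g * P⁻¹, ?_⟩
    simpa only [conj_frame_eq, inv_mul_cancel_right] using h

/-- **Residual distinguishedness of shape `a` does not see the frame.** [folklore] -/
theorem FramedRep.isResiduallyDistinguishedOfShape_conj_iff (P : GL (Fin n) (PadicAlgCl p))
    (ρ : FramedRep (absoluteGaloisGroup K) (PadicAlgCl p) n) (a : Fin n → ℕ) :
    (ρ.conj P).IsResiduallyDistinguishedOfShape a ↔ ρ.IsResiduallyDistinguishedOfShape a := by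
  constructor
  · rintro ⟨g, h⟩
    exact ⟨g * P, by simpa only [conj_frame_eq] using h⟩
  · rintro ⟨g, h⟩
    refine ⟨g * P⁻¹, ?_⟩
    simpa only [conj_frame_eq, inv_mul_cancel_right] using h

/-! #### Shape `0`; non-vacuity -/

/-- **Shape `0` is "unramified up to unipotent"**: `ρ` is ordinary of shape `0` iff in some frame it
is upper triangular with all diagonal characters trivial on inertia (inertia acts through upper
unitriangular matrices). [folklore] -/
theorem FramedRep.isCrystallineOrdinaryOfShape_zero_iff
    (ρ : FramedRep (absoluteGaloisGroup K) (PadicAlgCl p) n) :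
    ρ.IsCrystallineOrdinaryOfShape 0 ↔
      ∃ g : GL (Fin n) (PadicAlgCl p), (ρ.conj g).IsUpperTriangular ∧
        ∀ τ ∈ absInertia K, ∀ i : Fin n, (ρ.conj g).diagEntry i τ = 1 := by
  simp only [FramedRep.IsCrystallineOrdinaryOfShape, Pi.zero_apply, pow_zero]
  rfl

/-- **Greenberg shape `0`**: `ρ` is Greenberg-ordinary of shape `0` iff in some frame it is upper
triangular and TRIVIAL on inertia (diagonal entries `1`, off-diagonal entries `0` on `I_K`); in
particular `ρ` is then unramified (`IsGreenbergOrdinaryOfShape.isLocallyUnramified`). [folklore] -/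
theorem FramedRep.isGreenbergOrdinaryOfShape_zero_iff
    (ρ : FramedRep (absoluteGaloisGroup K) (PadicAlgCl p) n) :
    ρ.IsGreenbergOrdinaryOfShape 0 ↔
      ∃ g : GL (Fin n) (PadicAlgCl p), (ρ.conj g).IsUpperTriangular ∧
        ∀ τ ∈ absInertia K, ρ.conj g τ = 1 := by
  rw [FramedRep.isGreenbergOrdinaryOfShape_iff_conj]
  refine exists_congr fun g => and_congr_right fun _ => ?_
  constructor
  · rintro ⟨hdiag, hoff⟩ τ hτ
    ext i j
    by_cases hij : i = j
    · subst hij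
      simpa using hdiag τ hτ i
    · rw [hoff τ hτ i j hij rfl, Units.val_one, Matrix.one_apply_ne hij]
  · intro h
    refine ⟨fun τ hτ i => ?_, fun τ hτ i j hij _ => ?_⟩
    · simp [FramedRep.diagEntry_apply, h τ hτ]
    · simp [h τ hτ, Matrix.one_apply_ne hij]

/-- A Greenberg-ordinary representation of shape `0` is unramified (`FramedRep.IsLocallyUnramified`:
trivial on `I_K`), being conjugate to one. [folklore] -/
theorem FramedRep.IsGreenbergOrdinaryOfShape.isLocallyUnramified
    {ρ : FramedRep (absoluteGaloisGroup K) (PadicAlgCl p) n} (h : ρ.IsGreenbergOrdinaryOfShape 0) :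
    ρ.IsLocallyUnramified := by
  obtain ⟨g, -, hI⟩ := (FramedRep.isGreenbergOrdinaryOfShape_zero_iff ρ).1 h
  intro τ hτ
  have h1 := hI τ hτ
  rw [FramedRep.conj_apply, mul_inv_eq_one, mul_eq_left] at h1
  exact h1

/-- **Non-vacuity**: the trivial representation `1 : Γ_K →ₜ* GL_n(ℚ̄_p)` is Greenberg-ordinary of
shape `0` (frame `g = 1`). [folklore] -/
theorem FramedRep.isGreenbergOrdinaryOfShape_one_zero :
    (1 : FramedRep (absoluteGaloisGroup K) (PadicAlgCl p) n).IsGreenbergOrdinaryOfShape 0 := by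
  refine ⟨1, fun τ i j hij => ?_, fun τ _ i => ?_, fun τ _ i j hij _ => ?_⟩
  · simp [Matrix.one_apply_ne' hij.ne]
  · simp
  · simp [Matrix.one_apply_ne hij]

/-- The trivial representation is ordinary of shape `0`. [folklore] -/
theorem FramedRep.isCrystallineOrdinaryOfShape_one_zero :
    (1 : FramedRep (absoluteGaloisGroup K) (PadicAlgCl p) n).IsCrystallineOrdinaryOfShape 0 :=
  FramedRep.isGreenbergOrdinaryOfShape_one_zero.isCrystallineOrdinaryOfShape

/-! #### The bridge with `IsCrystallineOrdinaryOfExponents` -/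

/-- **Shape `a` ⇒ exponents `-a`**: an ordinary `ρ` of shape `a` is
`IsCrystallineOrdinaryOfExponents p ρ (-a)` with the unramified characters
`ψ_i = χ_i ε^{a_i}` (`IsUpperTriangular.diagCharCycTwistFramed`): on inertia
`χ_i = ε^{-a_i}`, so `ψ_i|_{I_K} = 1`, and `χ_i = ψ_i · ε^{-a_i}` identically. [folklore] -/
theorem FramedRep.IsCrystallineOrdinaryOfShape.isCrystallineOrdinaryOfExponents
    {ρ : FramedRep (absoluteGaloisGroup K) (PadicAlgCl p) n} {a : Fin n → ℕ}
    (h : ρ.IsCrystallineOrdinaryOfShape a) :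
    ρ.IsCrystallineOrdinaryOfExponents p (fun i => -(a i : ℤ)) := by
  obtain ⟨g, htri, hdiag⟩ := h
  have htri' : (ρ.conj g).IsUpperTriangular := htri
  refine ⟨g, fun i => htri'.diagCharCycTwistFramed i (a i), fun i σ hσ => ?_, htri', fun σ i => ?_⟩
  · have hd : (ρ.conj g).diagEntry i σ = algebraMap ℚ_[p] (PadicAlgCl p)
        ((((GaloisRep.cyclotomicCharacter K p σ)⁻¹ : ℤ_[p]ˣ) : ℤ_[p]) : ℚ_[p]) ^ a i := hdiag σ hσ i
    have hu : htri'.diagCharCycTwist i (a i) σ = 1 := by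
      ext
      rw [FramedRep.IsUpperTriangular.val_diagCharCycTwist_apply, hd,
        val_unitsMap_algebraMap_padicAlgCl, ← mul_pow, ← map_mul, ← PadicInt.coe_mul,
        Units.inv_mul, PadicInt.coe_one, map_one, one_pow, Units.val_one]
    change (FramedRep.unitsContinuousMulEquivOfUnique (Fin 1) (PadicAlgCl p))
        (htri'.diagCharCycTwist i (a i) σ) = 1
    rw [hu, map_one]
  · rw [FramedRep.IsUpperTriangular.trace_diagCharCycTwistFramed,
      FramedRep.IsUpperTriangular.val_diagCharCycTwist_apply, zpow_neg, zpow_natCast,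
      Units.val_inv_eq_inv_val, Units.val_pow_eq_pow_val, mul_assoc,
      mul_inv_cancel₀ (pow_ne_zero _ (Units.ne_zero _)), mul_one]

/-- **Exponents `-a` ⇒ shape `a`**: the unramified `ψ_i` are `1` on inertia, leaving
`χ_i|_{I_K} = ε^{-a_i}`. [folklore] -/
theorem FramedRep.IsCrystallineOrdinaryOfExponents.isCrystallineOrdinaryOfShape
    {ρ : FramedRep (absoluteGaloisGroup K) (PadicAlgCl p) n} {a : Fin n → ℕ}
    (h : ρ.IsCrystallineOrdinaryOfExponents p (fun i => -(a i : ℤ))) :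
    ρ.IsCrystallineOrdinaryOfShape a := by
  obtain ⟨g, ψ, hψ, htri, hdiag⟩ := h
  refine ⟨g, htri, fun τ hτ i => ?_⟩
  have h1 := hdiag τ i
  rw [FramedRep.diagEntry_apply, FramedRep.conj_apply, FramedRep.trace, hψ i τ hτ] at h1
  rw [h1, algebraMap_inv_cyclotomicCharacter_pow]
  simp [Matrix.trace_one]

/-- **The bridge**: over `ℚ̄_p`, ordinary of shape `a` ⟺ `IsCrystallineOrdinaryOfExponents p ρ (-a)`
(`CrystallineOrdinary.lean`; whence e.g. `IsCrystallineOrdinaryOfExponents.exists_det_eq`).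
[folklore] -/
theorem FramedRep.isCrystallineOrdinaryOfShape_iff_isCrystallineOrdinaryOfExponents
    (ρ : FramedRep (absoluteGaloisGroup K) (PadicAlgCl p) n) (a : Fin n → ℕ) :
    ρ.IsCrystallineOrdinaryOfShape a ↔ ρ.IsCrystallineOrdinaryOfExponents p (fun i => -(a i : ℤ)) :=
  ⟨fun h => h.isCrystallineOrdinaryOfExponents, fun h => h.isCrystallineOrdinaryOfShape⟩

/-- A STRICTLY INCREASING shape gives a (crystalline-)ordinary representation with distinct
exponents in the sense of `FramedRep.IsCrystallineOrdinary` (route `SiegelEisensteinFern`'s notion).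
[folklore] -/
theorem FramedRep.IsCrystallineOrdinaryOfShape.isCrystallineOrdinary
    {ρ : FramedRep (absoluteGaloisGroup K) (PadicAlgCl p) n} {a : Fin n → ℕ}
    (h : ρ.IsCrystallineOrdinaryOfShape a) (ha : StrictMono a) : ρ.IsCrystallineOrdinary p :=
  h.isCrystallineOrdinaryOfExponents.isCrystallineOrdinary fun i j hij => by
    simpa using ha hij

/-! #### One witness for the two doubled weights of shape `(0,1,1,2,2,3)` -/

/-- The pairs `i < j` of equal weight in the `GSpinRung` shape `(0,1,1,2,2,3)` are `(1,2)` and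
`(3,4)`. [folklore] -/
theorem gspin6Shape_eq_iff (i j : Fin 6) (hij : i < j) :
    (![0, 1, 1, 2, 2, 3] : Fin 6 → ℕ) i = ![0, 1, 1, 2, 2, 3] j ↔ i = 1 ∧ j = 2 ∨ i = 3 ∧ j = 4 := by
  revert i j
  decide

/-- **The `GSpinRung` clause, verbatim (local form).**  For `ρ : Γ_K →ₜ* GL_6(ℚ̄_p)`,
`IsResiduallyDistinguishedOfShape ρ (0,1,1,2,2,3)` is the route's inline clause with ONE witness `τ`
for both doubled weights: `∃ g, (upper triangular) ∧ (inertial diagonal ε^0,ε^-1,ε^-1,ε^-2,ε^-2,ε^-3) ∧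
∃ τ, ‖M τ 1 1 - M τ 2 2‖ = 1 ∧ ‖M τ 3 3 - M τ 4 4‖ = 1` (a group is not the union of two proper
subgroups, `IsUpperTriangular.exists_norm_diagEntry_sub_eq_one_and`; `Γ_K` is compact,
`absoluteGaloisGroup_compactSpace`). [folklore] -/
theorem FramedRep.isResiduallyDistinguishedOfShape_gspin6_iff
    (ρ : FramedRep (absoluteGaloisGroup K) (PadicAlgCl p) 6) :
    ρ.IsResiduallyDistinguishedOfShape ![0, 1, 1, 2, 2, 3] ↔
      ∃ g : GL (Fin 6) (PadicAlgCl p),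
        let M := fun τ =>
          ((g * ρ τ * g⁻¹ : GL (Fin 6) (PadicAlgCl p)) : Matrix (Fin 6) (Fin 6) (PadicAlgCl p));
        (∀ τ (i j : Fin 6), j < i → M τ i j = 0) ∧
          (∀ τ ∈ absInertia K, ∀ i : Fin 6, M τ i i =
            algebraMap ℚ_[p] (PadicAlgCl p)
              ((((GaloisRep.cyclotomicCharacter K p τ)⁻¹ : ℤ_[p]ˣ) : ℤ_[p]) : ℚ_[p]) ^
                (![0, 1, 1, 2, 2, 3] i : ℕ)) ∧
          ∃ τ, ‖M τ 1 1 - M τ 2 2‖ = 1 ∧ ‖M τ 3 3 - M τ 4 4‖ = 1 := by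
  haveI : CompactSpace (absoluteGaloisGroup K) := absoluteGaloisGroup_compactSpace K
  refine exists_congr fun g => ?_
  dsimp only
  refine and_congr_right fun htri => and_congr_right fun _ => ?_
  have htri' : (ρ.conj g).IsUpperTriangular := htri
  change (∀ i j : Fin 6, i < j → _ → ∃ τ, ‖(ρ.conj g).diagEntry i τ - (ρ.conj g).diagEntry j τ‖ = 1) ↔
    ∃ τ, ‖(ρ.conj g).diagEntry 1 τ - (ρ.conj g).diagEntry 2 τ‖ = 1 ∧
      ‖(ρ.conj g).diagEntry 3 τ - (ρ.conj g).diagEntry 4 τ‖ = 1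
  constructor
  · intro h
    exact htri'.exists_norm_diagEntry_sub_eq_one_and (h 1 2 (by decide) (by decide))
      (h 3 4 (by decide) (by decide))
  · rintro ⟨τ, h12, h34⟩ i j hij hij'
    rcases (gspin6Shape_eq_iff i j hij).1 hij' with ⟨rfl, rfl⟩ | ⟨rfl, rfl⟩
    exacts [⟨τ, h12⟩, ⟨τ, h34⟩]

end Local

/-! ### The global predicates at a finite place -/

section Global

variable {K : Type} [Field K] [NumberField K] {p : ℕ} [Fact p.Prime] {n : ℕ}

/-- **`ρ : Γ_K →ₜ* GL_n(ℚ̄_p)` is (crystalline-)ordinary of inertial shape `a` at the finite place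
`v`** of the number field `K` (intended `v ∣ p`): its restriction `ρ.toLocal v` to the decomposition
group `Γ_{K_v}` (`K_v = v.adicCompletion K`) is `FramedRep.IsCrystallineOrdinaryOfShape a` — the
clause of route `GSpinRung` (`isCrystallineOrdinaryOfShapeAt_iff`).  Weak for repeated weights, see
`FramedRep.IsCrystallineOrdinaryOfShape` and the module docstring.
[cite: Greenberg1991, §2 (ordinary p-adic representation; full-flag form, diagonal condition only)] -/
def FramedGaloisRep.IsCrystallineOrdinaryOfShapeAt (v : HeightOneSpectrum (𝓞 K))
    (ρ : FramedGaloisRep K (PadicAlgCl p) n) (a : Fin n → ℕ) : Prop :=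
  (ρ.toLocal v).IsCrystallineOrdinaryOfShape a

/-- **Greenberg-ordinary of inertial shape `a` at `v`**: `ρ.toLocal v` is
`FramedRep.IsGreenbergOrdinaryOfShape a` (inertia at `v` acts on the block of weight `w` through the
scalar `ε^{-w}`).  [cite: Greenberg1991, §2 (definition of an ordinary p-adic representation)] -/
def FramedGaloisRep.IsGreenbergOrdinaryOfShapeAt (v : HeightOneSpectrum (𝓞 K))
    (ρ : FramedGaloisRep K (PadicAlgCl p) n) (a : Fin n → ℕ) : Prop :=
  (ρ.toLocal v).IsGreenbergOrdinaryOfShape a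

/-- **Ordinary of shape `a` and `p`-distinguished at `v`**: `ρ.toLocal v` is
`FramedRep.IsResiduallyDistinguishedOfShape a` (a triangular frame of inertial shape `a` in which
diagonal characters of equal weight are pairwise residually distinct).
[cite: BoxerEtAl2021, §7.3 (first Definition: ᾱ_v ≠ β̄_v)] -/
def FramedGaloisRep.IsResiduallyDistinguishedAt (v : HeightOneSpectrum (𝓞 K))
    (ρ : FramedGaloisRep K (PadicAlgCl p) n) (a : Fin n → ℕ) : Prop :=
  (ρ.toLocal v).IsResiduallyDistinguishedOfShape a

/-- **The route's clause, verbatim (ordinarity at `v`)** — e.g. the seed clause of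
`GSpinRung.PotentialOrdinarySeedSp6` / `AutomorphyLiftingSp6` with `a = ![0, 1, 1, 2, 2, 3]`. [folklore] -/
theorem FramedGaloisRep.isCrystallineOrdinaryOfShapeAt_iff (v : HeightOneSpectrum (𝓞 K))
    (ρ : FramedGaloisRep K (PadicAlgCl p) n) (a : Fin n → ℕ) :
    ρ.IsCrystallineOrdinaryOfShapeAt v a ↔
      ∃ g : GL (Fin n) (PadicAlgCl p),
        let M := fun τ =>
          ((g * ρ.toLocal v τ * g⁻¹ : GL (Fin n) (PadicAlgCl p)) :
            Matrix (Fin n) (Fin n) (PadicAlgCl p));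
        (∀ τ (i j : Fin n), j < i → M τ i j = 0) ∧
          (∀ τ ∈ absInertia (v.adicCompletion K), ∀ i : Fin n, M τ i i =
            algebraMap ℚ_[p] (PadicAlgCl p)
              ((((GaloisRep.cyclotomicCharacter (v.adicCompletion K) p τ)⁻¹ : ℤ_[p]ˣ) : ℤ_[p]) :
                ℚ_[p]) ^ (a i : ℕ)) :=
  Iff.rfl

/-- Unfolding of `IsGreenbergOrdinaryOfShapeAt`. [folklore] -/
theorem FramedGaloisRep.isGreenbergOrdinaryOfShapeAt_iff (v : HeightOneSpectrum (𝓞 K))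
    (ρ : FramedGaloisRep K (PadicAlgCl p) n) (a : Fin n → ℕ) :
    ρ.IsGreenbergOrdinaryOfShapeAt v a ↔ (ρ.toLocal v).IsGreenbergOrdinaryOfShape a :=
  Iff.rfl

/-- **The route's clause, verbatim (distinguishedness at `v`, general shape).** [folklore] -/
theorem FramedGaloisRep.isResiduallyDistinguishedAt_iff (v : HeightOneSpectrum (𝓞 K))
    (ρ : FramedGaloisRep K (PadicAlgCl p) n) (a : Fin n → ℕ) :
    ρ.IsResiduallyDistinguishedAt v a ↔
      ∃ g : GL (Fin n) (PadicAlgCl p),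
        let M := fun τ =>
          ((g * ρ.toLocal v τ * g⁻¹ : GL (Fin n) (PadicAlgCl p)) :
            Matrix (Fin n) (Fin n) (PadicAlgCl p));
        (∀ τ (i j : Fin n), j < i → M τ i j = 0) ∧
          (∀ τ ∈ absInertia (v.adicCompletion K), ∀ i : Fin n, M τ i i =
            algebraMap ℚ_[p] (PadicAlgCl p)
              ((((GaloisRep.cyclotomicCharacter (v.adicCompletion K) p τ)⁻¹ : ℤ_[p]ˣ) : ℤ_[p]) :
                ℚ_[p]) ^ (a i : ℕ)) ∧
          ∀ i j : Fin n, i < j → a i = a j → ∃ τ, ‖M τ i i - M τ j j‖ = 1 :=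
  Iff.rfl

/-- Greenberg-ordinary at `v` ⇒ ordinary at `v`. [folklore] -/
theorem FramedGaloisRep.IsGreenbergOrdinaryOfShapeAt.isCrystallineOrdinaryOfShapeAt
    {v : HeightOneSpectrum (𝓞 K)} {ρ : FramedGaloisRep K (PadicAlgCl p) n} {a : Fin n → ℕ}
    (h : ρ.IsGreenbergOrdinaryOfShapeAt v a) : ρ.IsCrystallineOrdinaryOfShapeAt v a :=
  FramedRep.IsGreenbergOrdinaryOfShape.isCrystallineOrdinaryOfShape h

/-- Residually distinguished at `v` ⇒ ordinary at `v`. [folklore] -/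
theorem FramedGaloisRep.IsResiduallyDistinguishedAt.isCrystallineOrdinaryOfShapeAt
    {v : HeightOneSpectrum (𝓞 K)} {ρ : FramedGaloisRep K (PadicAlgCl p) n} {a : Fin n → ℕ}
    (h : ρ.IsResiduallyDistinguishedAt v a) : ρ.IsCrystallineOrdinaryOfShapeAt v a :=
  FramedRep.IsResiduallyDistinguishedOfShape.isCrystallineOrdinaryOfShape h

/-- For an injective shape the two ordinarity predicates at `v` coincide. [folklore] -/
theorem FramedGaloisRep.isGreenbergOrdinaryOfShapeAt_iff_of_injective (v : HeightOneSpectrum (𝓞 K))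
    (ρ : FramedGaloisRep K (PadicAlgCl p) n) {a : Fin n → ℕ} (ha : Function.Injective a) :
    ρ.IsGreenbergOrdinaryOfShapeAt v a ↔ ρ.IsCrystallineOrdinaryOfShapeAt v a :=
  FramedRep.isGreenbergOrdinaryOfShape_iff_of_injective (ρ.toLocal v) ha

/-- **Ordinarity of shape `a` at `v` does not see the frame** (`FramedGaloisRep.toLocal_conj`).
[folklore] -/
theorem FramedGaloisRep.isCrystallineOrdinaryOfShapeAt_conj_iff (v : HeightOneSpectrum (𝓞 K))
    (P : GL (Fin n) (PadicAlgCl p)) (ρ : FramedGaloisRep K (PadicAlgCl p) n) (a : Fin n → ℕ) :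
    FramedGaloisRep.IsCrystallineOrdinaryOfShapeAt v (FramedRep.conj P ρ) a ↔
      ρ.IsCrystallineOrdinaryOfShapeAt v a := by
  rw [FramedGaloisRep.IsCrystallineOrdinaryOfShapeAt, FramedGaloisRep.toLocal_conj]
  exact FramedRep.isCrystallineOrdinaryOfShape_conj_iff P (ρ.toLocal v) a

/-- **Greenberg-ordinarity of shape `a` at `v` does not see the frame.** [folklore] -/
theorem FramedGaloisRep.isGreenbergOrdinaryOfShapeAt_conj_iff (v : HeightOneSpectrum (𝓞 K))
    (P : GL (Fin n) (PadicAlgCl p)) (ρ : FramedGaloisRep K (PadicAlgCl p) n) (a : Fin n → ℕ) :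
    FramedGaloisRep.IsGreenbergOrdinaryOfShapeAt v (FramedRep.conj P ρ) a ↔
      ρ.IsGreenbergOrdinaryOfShapeAt v a := by
  rw [FramedGaloisRep.IsGreenbergOrdinaryOfShapeAt, FramedGaloisRep.toLocal_conj]
  exact FramedRep.isGreenbergOrdinaryOfShape_conj_iff P (ρ.toLocal v) a

/-- **Residual distinguishedness at `v` does not see the frame.** [folklore] -/
theorem FramedGaloisRep.isResiduallyDistinguishedAt_conj_iff (v : HeightOneSpectrum (𝓞 K))
    (P : GL (Fin n) (PadicAlgCl p)) (ρ : FramedGaloisRep K (PadicAlgCl p) n) (a : Fin n → ℕ) :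
    FramedGaloisRep.IsResiduallyDistinguishedAt v (FramedRep.conj P ρ) a ↔
      ρ.IsResiduallyDistinguishedAt v a := by
  rw [FramedGaloisRep.IsResiduallyDistinguishedAt, FramedGaloisRep.toLocal_conj]
  exact FramedRep.isResiduallyDistinguishedOfShape_conj_iff P (ρ.toLocal v) a

/-- Ordinary of shape `a` at `v` ⟺ `IsCrystallineOrdinaryOfExponents p (ρ.toLocal v) (-a)`.
[folklore] -/
theorem FramedGaloisRep.isCrystallineOrdinaryOfShapeAt_iff_isCrystallineOrdinaryOfExponents
    (v : HeightOneSpectrum (𝓞 K)) (ρ : FramedGaloisRep K (PadicAlgCl p) n) (a : Fin n → ℕ) :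
    ρ.IsCrystallineOrdinaryOfShapeAt v a ↔
      (ρ.toLocal v).IsCrystallineOrdinaryOfExponents p (fun i => -(a i : ℤ)) :=
  FramedRep.isCrystallineOrdinaryOfShape_iff_isCrystallineOrdinaryOfExponents (ρ.toLocal v) a

/-- A strictly increasing shape at `v` gives `FramedGaloisRep.IsCrystallineOrdinaryAt p v ρ`
(route `SiegelEisensteinFern`'s notion, `CrystallineOrdinary.lean`). [folklore] -/
theorem FramedGaloisRep.IsCrystallineOrdinaryOfShapeAt.isCrystallineOrdinaryAt
    {v : HeightOneSpectrum (𝓞 K)} {ρ : FramedGaloisRep K (PadicAlgCl p) n} {a : Fin n → ℕ}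
    (h : ρ.IsCrystallineOrdinaryOfShapeAt v a) (ha : StrictMono a) :
    ρ.IsCrystallineOrdinaryAt p v :=
  FramedRep.IsCrystallineOrdinaryOfShape.isCrystallineOrdinary h ha

/-- **The `GSpinRung` hypothesis, verbatim.**  For `ρ : Γ_K →ₜ* GL_6(ℚ̄_p)`,
`ρ.IsResiduallyDistinguishedAt v (0,1,1,2,2,3)` is literally the "crystalline-ordinary and
`p`-distinguished at `v`" clause of `GSpinRung.PotentialAutomorphySp6` / `AutomorphyLiftingSp6` /
`PotentialOrdinarySeedSp6`: `∃ g, (upper triangular) ∧ (inertial diagonal) ∧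
∃ τ, ‖M τ 1 1 - M τ 2 2‖ = 1 ∧ ‖M τ 3 3 - M τ 4 4‖ = 1`, `M τ = ↑(g * ρ.toLocal v τ * g⁻¹)`. [folklore] -/
theorem FramedGaloisRep.isResiduallyDistinguishedAt_gspin6_iff (v : HeightOneSpectrum (𝓞 K))
    (ρ : FramedGaloisRep K (PadicAlgCl p) 6) :
    ρ.IsResiduallyDistinguishedAt v ![0, 1, 1, 2, 2, 3] ↔
      ∃ g : GL (Fin 6) (PadicAlgCl p),
        let M := fun τ =>
          ((g * ρ.toLocal v τ * g⁻¹ : GL (Fin 6) (PadicAlgCl p)) :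
            Matrix (Fin 6) (Fin 6) (PadicAlgCl p));
        (∀ τ (i j : Fin 6), j < i → M τ i j = 0) ∧
          (∀ τ ∈ absInertia (v.adicCompletion K), ∀ i : Fin 6, M τ i i =
            algebraMap ℚ_[p] (PadicAlgCl p)
              ((((GaloisRep.cyclotomicCharacter (v.adicCompletion K) p τ)⁻¹ : ℤ_[p]ˣ) : ℤ_[p]) :
                ℚ_[p]) ^ (![0, 1, 1, 2, 2, 3] i : ℕ)) ∧
          ∃ τ, ‖M τ 1 1 - M τ 2 2‖ = 1 ∧ ‖M τ 3 3 - M τ 4 4‖ = 1 :=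
  FramedRep.isResiduallyDistinguishedOfShape_gspin6_iff (ρ.toLocal v)

end Global

end Literature.NumberTheory.GaloisRepresentations
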